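import Literature.MathematicalPhysics.QuantumFieldTheory.StrongCouplingClustering
import Literature.MathematicalPhysics.QuantumFieldTheory.StrongCouplingActivities
import Literature.Probability.LatticeModels.ProductMeasureTools
import HarnessLib

/-!
# Strong-coupling expansion of lattice gauge theory: the replica expansion

Second analytic layer of the proof of the sup-norm form of Osterwalder–Seiler clustering
(`osterwalderSeiler_clustering_supNorm` of `StrongCouplingClustering`; Osterwalder–Seiler,
Ann. Phys. **110** (1978) 440, §3). Everything here is proved.

* **The doubled (replica) configuration space** `DblConfig d G = (ZdEdge d × Bool) → G` with
  the product Haar measure `dblHaar` realised as *one* `Measure.infinitePi` (so that the tools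
  of `ProductMeasureTools` apply): the two replicas `fst`, `snd` are `dg_∞`-distributed
  (`map_fst_dblHaar`) and independent (`integral_fst_mul_snd_dblHaar`).
* **The doubled activity** `g_p(U,U') = (1 + f̃_p(U))(1 + f̃_p(U')) - 1` (`dblActivity`):
  `|g_p| ≤ e^{4|β|B} - 1` uniformly (`abs_dblActivity_le`), measurable, supported on the
  doubled bonds of `p`, and with **zero mean over the two copies of each of its bonds**
  (`integral_mul_dblActivity_eq_zero`, from `integral_update_plaqActivity` and
  `integral_infinitePi_eq_zero_of_update`).
* **The local swap symmetry** (`swapEquiv`, `DblConfig.swapOn`, `integral_comp_swapOn`):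
  exchanging the replicas on the bonds joined to `E₁` through `Q` (`joinedLinks`; all-or-nothing
  on each plaquette of `Q`, `plaquetteEdges_subset_or_disjoint_joinedLinks`) preserves the
  measure and every `g_p`, fixes `F₂(U) - F₂(U')` and flips `F₁(U) - F₁(U')` when `E₁` is not
  joined to `E₂`: `integral_trunc_prod_dblActivity_eq_zero_of_not_joined`.
* **Only connecting surfaces contribute**: the expansion term
  `I(Q) = ∫ (F₁(U)-F₁(U'))(F₂(U)-F₂(U')) ∏_{p ∈ Q} g_p` (`expansionTerm`) vanishes unless `Q`
  is an `IsConnectingSurface E₁ E₂ Q` (`expansionTerm_eq_zero_of_not_isConnectingSurface`: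
  disconnected — swap symmetry; a free bond covered once — zero mean).
* **Expectations and the replica formula**: `⟨F⟩_{Λ,β} = ∫ F W̃ dg_∞ / ∫ W̃ dg_∞` with the
  normalised Gibbs factor `W̃ = ∏_{p ∈ Λ'} (1 + f̃_p)` (`zdExpect_eq_div`; the constants
  `e^{-βN}` and `c(β)` per plaquette cancel), and
  `⟨F₁F₂⟩ - ⟨F₁⟩⟨F₂⟩ = (Σ_{Q ⊆ Λ'} I(Q)) / (2 Z₂)`, `Z₂ = ∫ W̃(U) W̃(U') = (∫ W̃)² > 0`
  (`truncated_eq_integral_div`, `truncated_eq_sum_expansionTerm_div`).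

The resummation over seeded components, Dobrushin's criterion for the free polymer gas and
the final bound are in `StrongCouplingExpansion`.

## Mathlib anchors

`MeasureTheory.Measure.infinitePi`, `Measure.map_infinitePi_infinitePi_of_inj`,
`MeasureTheory.integral_prod`, `integral_withDensity_eq_integral_smul`,
`ofReal_integral_eq_lintegral_ofReal`, `Finset.prod_one_add`, `integral_finsetSum`,
`Integrable.of_bound`, `Function.update`.

## References

* K. Osterwalder, E. Seiler, *Gauge field theories on a lattice*, Ann. Phys. **110** (1978)
  440–471, §3 (strong-coupling cluster expansion; Remark (3.9)). [OsterwalderSeilerAnnPhys1978]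
* E. Seiler, *Gauge Theories as a Problem of Constructive Quantum Field Theory and Statistical
  Mechanics*, LNP **159** (1982), Ch. 2. [SeilerLNP1982]
-/

/-! ## The doubled (replica) configuration space -/

namespace Literature.MathematicalPhysics.QuantumFieldTheory

open MeasureTheory Measure ProbabilityTheory

noncomputable section

/-- Doubled bond set: two copies of every bond of `ℤ^d`. [folklore] -/
abbrev DblEdge (d : ℕ) : Type := ZdEdge d × Bool

/-- Doubled (replica) configurations: a group element on every bond of each copy. [folklore] -/
abbrev DblConfig (d : ℕ) (G : Type*) : Type _ := DblEdge d → G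

namespace DblConfig

variable {d : ℕ} {G : Type*}

/-- The first replica `U = W(·, ff)`. [folklore] -/
def fst (W : DblConfig d G) : ZdGaugeConfig d G := fun e => W (e, false)

/-- The second replica `U' = W(·, tt)`. [folklore] -/
def snd (W : DblConfig d G) : ZdGaugeConfig d G := fun e => W (e, true)

/-- `W.fst e = W (e, ff)`. [folklore] -/
@[simp] theorem fst_apply (W : DblConfig d G) (e : ZdEdge d) : W.fst e = W (e, false) := rfl
/-- `W.snd e = W (e, tt)`. [folklore] -/
@[simp] theorem snd_apply (W : DblConfig d G) (e : ZdEdge d) : W.snd e = W (e, true) := rfl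

/-- Updating the bond `(ℓ, ff)` updates the first replica at `ℓ`. [folklore] -/
theorem fst_update_false [DecidableEq (ZdEdge d)] (W : DblConfig d G) (ℓ : ZdEdge d) (g : G) :
    fst (Function.update W (ℓ, false) g) = Function.update W.fst ℓ g := by
  ext e
  by_cases h : e = ℓ
  · subst h; simp [fst]
  · rw [Function.update_of_ne h]; simp [fst, h]

/-- Updating the bond `(ℓ, tt)` does not change the first replica. [folklore] -/
theorem fst_update_true [DecidableEq (ZdEdge d)] (W : DblConfig d G) (ℓ : ZdEdge d) (g : G) :
    fst (Function.update W (ℓ, true) g) = W.fst := by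
  ext e; simp [fst]

/-- Updating the bond `(ℓ, tt)` updates the second replica at `ℓ`. [folklore] -/
theorem snd_update_true [DecidableEq (ZdEdge d)] (W : DblConfig d G) (ℓ : ZdEdge d) (g : G) :
    snd (Function.update W (ℓ, true) g) = Function.update W.snd ℓ g := by
  ext e
  by_cases h : e = ℓ
  · subst h; simp [snd]
  · rw [Function.update_of_ne h]; simp [snd, h]

/-- Updating the bond `(ℓ, ff)` does not change the second replica. [folklore] -/
theorem snd_update_false [DecidableEq (ZdEdge d)] (W : DblConfig d G) (ℓ : ZdEdge d) (g : G) :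
    snd (Function.update W (ℓ, false) g) = W.snd := by
  ext e; simp [snd]

/-- `fst` is measurable. [folklore] -/
theorem measurable_fst [MeasurableSpace G] :
    Measurable (fst : DblConfig d G → ZdGaugeConfig d G) :=
  measurable_pi_lambda _ fun _ => measurable_pi_apply _

/-- `snd` is measurable. [folklore] -/
theorem measurable_snd [MeasurableSpace G] :
    Measurable (snd : DblConfig d G → ZdGaugeConfig d G) :=
  measurable_pi_lambda _ fun _ => measurable_pi_apply _

/-- A function of the first replica depending on the bonds `E` depends on `E × {ff}`.
[folklore] -/
theorem dependsOn_comp_fst {α : Type*} {F : ZdGaugeConfig d G → α} {E : Finset (ZdEdge d)}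
    (hF : DependsOn F (E : Set (ZdEdge d))) :
    DependsOn (fun W : DblConfig d G => F W.fst)
      ((E ×ˢ ({false} : Finset Bool) : Finset (DblEdge d)) : Set (DblEdge d)) :=
  fun _ _ h => hF fun e he => h (e, false)
    (Finset.mem_coe.2 (Finset.mem_product.2 ⟨Finset.mem_coe.1 he, Finset.mem_singleton_self _⟩))

/-- A function of the second replica depending on the bonds `E` depends on `E × {tt}`.
[folklore] -/
theorem dependsOn_comp_snd {α : Type*} {F : ZdGaugeConfig d G → α} {E : Finset (ZdEdge d)}
    (hF : DependsOn F (E : Set (ZdEdge d))) :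
    DependsOn (fun W : DblConfig d G => F W.snd)
      ((E ×ˢ ({true} : Finset Bool) : Finset (DblEdge d)) : Set (DblEdge d)) :=
  fun _ _ h => hF fun e he => h (e, true)
    (Finset.mem_coe.2 (Finset.mem_product.2 ⟨Finset.mem_coe.1 he, Finset.mem_singleton_self _⟩))

end DblConfig

section Measure

variable {d : ℕ} {G : Type*} [Group G] [TopologicalSpace G] [IsTopologicalGroup G]
  [CompactSpace G] [MeasurableSpace G] [BorelSpace G]

variable (d G) in
/-- The doubled product Haar measure `dg_∞ ⊗ dg_∞`, realised as one product over `DblEdge d`.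
[folklore] -/
def dblHaar : Measure (DblConfig d G) := infinitePi fun _ : DblEdge d => haarProbability G

/-- `dblHaar` is a probability measure. [folklore] -/
instance dblHaar.instIsProbabilityMeasure : IsProbabilityMeasure (dblHaar d G) := by
  unfold dblHaar; infer_instance

/-- The first replica is `dg_∞`-distributed. [folklore] -/
theorem map_fst_dblHaar : (dblHaar d G).map DblConfig.fst = zdHaar d G := by
  have h := map_infinitePi_infinitePi_of_inj (P := fun _ : DblEdge d => haarProbability G)
    (f := fun e : ZdEdge d => (e, false)) (fun a b h => (Prod.ext_iff.1 h).1)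
  exact h

/-- The second replica is `dg_∞`-distributed. [folklore] -/
theorem map_snd_dblHaar : (dblHaar d G).map DblConfig.snd = zdHaar d G := by
  have h := map_infinitePi_infinitePi_of_inj (P := fun _ : DblEdge d => haarProbability G)
    (f := fun e : ZdEdge d => (e, true)) (fun a b h => (Prod.ext_iff.1 h).1)
  exact h

/-- Integrals of functions of one replica. [folklore] -/
theorem integral_comp_fst_dblHaar {F : ZdGaugeConfig d G → ℝ}
    (hF : AEStronglyMeasurable F (zdHaar d G)) :
    ∫ W, F W.fst ∂dblHaar d G = ∫ U, F U ∂zdHaar d G := by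
  rw [← map_fst_dblHaar, integral_map DblConfig.measurable_fst.aemeasurable]
  rwa [map_fst_dblHaar]

/-- Integrals of functions of the second replica. [folklore] -/
theorem integral_comp_snd_dblHaar {F : ZdGaugeConfig d G → ℝ}
    (hF : AEStronglyMeasurable F (zdHaar d G)) :
    ∫ W, F W.snd ∂dblHaar d G = ∫ U, F U ∂zdHaar d G := by
  rw [← map_snd_dblHaar, integral_map DblConfig.measurable_snd.aemeasurable]
  rwa [map_snd_dblHaar]

/-- **Replica factorisation**: `∫ A(U) B(U') = ∫ A · ∫ B` for bounded measurable local `A`, `B`.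
[folklore] -/
theorem integral_fst_mul_snd_dblHaar {A B : ZdGaugeConfig d G → ℝ} (hAm : Measurable A)
    (hBm : Measurable B) {EA EB : Finset (ZdEdge d)} (hA : DependsOn A (EA : Set (ZdEdge d)))
    (hB : DependsOn B (EB : Set (ZdEdge d))) :
    ∫ W, A W.fst * B W.snd ∂dblHaar d G = (∫ U, A U ∂zdHaar d G) * ∫ U, B U ∂zdHaar d G := by
  classical
  have h := Literature.Probability.LatticeModels.integral_mul_eq_of_dependsOn_disjoint
    (fun _ : DblEdge d => haarProbability G)
    (S := EA ×ˢ ({false} : Finset Bool)) (T := EB ×ˢ ({true} : Finset Bool))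
    (F := fun W : DblConfig d G => A W.fst) (G := fun W : DblConfig d G => B W.snd)
    (by
      rw [Finset.disjoint_left]
      rintro ⟨e, b⟩ h1 h2
      simp only [Finset.mem_product, Finset.mem_singleton] at h1 h2
      exact Bool.false_ne_true (h1.2.symm.trans h2.2))
    (hAm.comp DblConfig.measurable_fst) (hBm.comp DblConfig.measurable_snd)
    (DblConfig.dependsOn_comp_fst hA) (DblConfig.dependsOn_comp_snd hB)
  rw [dblHaar, h, ← dblHaar, integral_comp_fst_dblHaar hAm.aestronglyMeasurable,
    integral_comp_snd_dblHaar hBm.aestronglyMeasurable]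

end Measure

section Activity

variable {d N : ℕ} {G : Type*} [Group G] [TopologicalSpace G] [IsTopologicalGroup G]
  [CompactSpace G] [MeasurableSpace G] [BorelSpace G] (ρ : G →* Matrix (Fin N) (Fin N) ℂ)

/-- The doubled plaquette activity `g_p(U, U') = (1 + f̃_p(U))(1 + f̃_p(U')) - 1` of the
replica expansion `W(U) W(U') = ∏_p (1 + g_p)`. [folklore] -/
def dblActivity (β : ℝ) (x : Literature.Probability.LatticeModels.Site d) (i j : Fin d) (W : DblConfig d G) : ℝ :=
  (1 + plaqActivity ρ β x i j W.fst) * (1 + plaqActivity ρ β x i j W.snd) - 1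

/-- `g_p = f̃_p(U) (1 + f̃_p(U')) + f̃_p(U')`. [folklore] -/
theorem dblActivity_eq (β : ℝ) (x : Literature.Probability.LatticeModels.Site d) (i j : Fin d) (W : DblConfig d G) :
    dblActivity ρ β x i j W =
      plaqActivity ρ β x i j W.fst * (1 + plaqActivity ρ β x i j W.snd) +
        plaqActivity ρ β x i j W.snd := by
  unfold dblActivity; ring

/-- **Smallness of the doubled activity**, uniformly in `β`: `|g_p| ≤ (e^{2|β|B})² - 1`.
[folklore] -/
theorem abs_dblActivity_le (hρ : Continuous ρ) :
    ∃ B : ℝ, 0 ≤ B ∧ ∀ (β : ℝ) (x : Literature.Probability.LatticeModels.Site d) (i j : Fin d) (W : DblConfig d G),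
      |dblActivity ρ β x i j W| ≤ Real.exp (2 * |β| * B) ^ 2 - 1 := by
  obtain ⟨B, hB0, hB⟩ := abs_plaqActivity_le ρ hρ
  refine ⟨B, hB0, fun β x i j W => ?_⟩
  set E := Real.exp (2 * |β| * B) with hE
  have hE1 : 1 ≤ E := Real.one_le_exp (by positivity)
  have h1 := hB β x i j W.fst
  have h2 := hB β x i j W.snd
  unfold dblActivity
  rw [abs_le] at h1 h2 ⊢
  set a := plaqActivity ρ β x i j W.fst
  set b := plaqActivity ρ β x i j W.snd
  -- `1 + a, 1 + b ∈ [2 - E, E]` with `2 - E ≤ E`; the product lies in `[-(E² - 1) + 1, E²]`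
  have ha1 : 2 - E ≤ 1 + a := by linarith [h1.1]
  have ha2 : 1 + a ≤ E := by linarith [h1.2]
  have hb1 : 2 - E ≤ 1 + b := by linarith [h2.1]
  have hb2 : 1 + b ≤ E := by linarith [h2.2]
  have hA : |1 + a| ≤ E := abs_le.2 ⟨by linarith, ha2⟩
  have hBb : |1 + b| ≤ E := abs_le.2 ⟨by linarith, hb2⟩
  have hupper : (1 + a) * (1 + b) ≤ E ^ 2 := by
    calc (1 + a) * (1 + b) ≤ |(1 + a) * (1 + b)| := le_abs_self _
      _ = |1 + a| * |1 + b| := abs_mul _ _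
      _ ≤ E * E := mul_le_mul hA hBb (abs_nonneg _) (by linarith)
      _ = E ^ 2 := (sq E).symm
  have hlower : 2 - E ^ 2 ≤ (1 + a) * (1 + b) := by
    by_cases ha : 0 ≤ 1 + a
    · by_cases hb : 0 ≤ 1 + b
      · by_cases hE2 : E ≤ 2
        · have h5 : (2 - E) * (2 - E) ≤ (1 + a) * (1 + b) :=
            mul_le_mul ha1 hb1 (by linarith) ha
          nlinarith
        · have h5 : 0 ≤ (1 + a) * (1 + b) := mul_nonneg ha hb
          nlinarith
      · -- `1 + b < 0`: `(1+a)(1+b) ≥ E (1+b) ≥ E (2 - E)`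
        have hb' : 1 + b < 0 := lt_of_not_ge hb
        have h3 : E * (1 + b) ≤ (1 + a) * (1 + b) :=
          mul_le_mul_of_nonpos_right ha2 hb'.le
        have h4 : E * (2 - E) ≤ E * (1 + b) := mul_le_mul_of_nonneg_left hb1 (by linarith)
        nlinarith
    · have ha' : 1 + a < 0 := lt_of_not_ge ha
      have h3 : (1 + a) * E ≤ (1 + a) * (1 + b) := mul_le_mul_of_nonpos_left hb2 ha'.le
      have h4 : (2 - E) * E ≤ (1 + a) * E := mul_le_mul_of_nonneg_right ha1 (by linarith)
      nlinarith
  constructor <;> linarith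

/-! ### Measurability, support and the zero-mean property of the doubled activity -/

/-- `f̃_p` is measurable (for the product σ-algebra, any compact `G`). [folklore] -/
theorem measurable_plaqActivity (hρ : Continuous ρ) (β : ℝ) (x : Literature.Probability.LatticeModels.Site d) (i j : Fin d) :
    Measurable (plaqActivity ρ β x i j : ZdGaugeConfig d G → ℝ) := by
  unfold plaqActivity
  exact ((Real.measurable_exp.comp
    ((measurable_trace_re_plaquette ρ hρ x i j).const_mul β)).div_const _).sub_const _

/-- `g_p` is measurable. [folklore] -/
theorem measurable_dblActivity (hρ : Continuous ρ) (β : ℝ) (x : Literature.Probability.LatticeModels.Site d) (i j : Fin d) :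
    Measurable (dblActivity ρ β x i j : DblConfig d G → ℝ) := by
  unfold dblActivity
  exact ((((measurable_plaqActivity ρ hρ β x i j).comp DblConfig.measurable_fst).const_add 1).mul
    (((measurable_plaqActivity ρ hρ β x i j).comp
      DblConfig.measurable_snd).const_add 1)).sub_const 1

/-- `f̃_p` depends only on the four bonds of `p`. [folklore] -/
theorem dependsOn_plaqActivity (β : ℝ) (p : QuantumLattice.ZdPlaquette d) :
    DependsOn (plaqActivity ρ β p.1 p.2.1.1 p.2.1.2 : ZdGaugeConfig d G → ℝ)
      (QuantumLattice.plaquetteEdges p : Set (ZdEdge d)) := by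
  intro U V h
  unfold plaqActivity
  have hUV := ZdGaugeConfig.dependsOn_plaquette (G := G) p h
  simp only at hUV
  rw [hUV]

/-- `g_p` depends only on the doubled bonds of `p`. [folklore] -/
theorem dependsOn_dblActivity (β : ℝ) (p : QuantumLattice.ZdPlaquette d) :
    DependsOn (dblActivity ρ β p.1 p.2.1.1 p.2.1.2 : DblConfig d G → ℝ)
      ((QuantumLattice.plaquetteEdges p ×ˢ (Finset.univ : Finset Bool) : Finset (DblEdge d)) :
        Set (DblEdge d)) := by
  intro W W' h
  unfold dblActivity
  have h1 : plaqActivity ρ β p.1 p.2.1.1 p.2.1.2 (DblConfig.fst W) =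
      plaqActivity ρ β p.1 p.2.1.1 p.2.1.2 (DblConfig.fst W') :=
    dependsOn_plaqActivity ρ β p fun e he => h (e, false)
      (Finset.mem_coe.2 (Finset.mem_product.2 ⟨Finset.mem_coe.1 he, Finset.mem_univ _⟩))
  have h2 : plaqActivity ρ β p.1 p.2.1.1 p.2.1.2 (DblConfig.snd W) =
      plaqActivity ρ β p.1 p.2.1.1 p.2.1.2 (DblConfig.snd W') :=
    dependsOn_plaqActivity ρ β p fun e he => h (e, true)
      (Finset.mem_coe.2 (Finset.mem_product.2 ⟨Finset.mem_coe.1 he, Finset.mem_univ _⟩))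
  change (1 + plaqActivity ρ β _ _ _ (DblConfig.fst W)) *
      (1 + plaqActivity ρ β _ _ _ (DblConfig.snd W)) - 1 =
    (1 + plaqActivity ρ β _ _ _ (DblConfig.fst W')) *
      (1 + plaqActivity ρ β _ _ _ (DblConfig.snd W')) - 1
  rw [h1, h2]

/-- The four bonds of `p`, as the disjunction used by `integral_update_plaqActivity`.
[folklore] -/
theorem eq_or_of_mem_plaquetteEdges {p : QuantumLattice.ZdPlaquette d} {e : ZdEdge d}
    (he : e ∈ QuantumLattice.plaquetteEdges p) :
    e = (p.1, p.2.1.1) ∨ e = (p.1 + Pi.single p.2.1.1 1, p.2.1.2) ∨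
      e = (p.1 + Pi.single p.2.1.2 1, p.2.1.1) ∨ e = (p.1, p.2.1.2) := by
  simpa [QuantumLattice.plaquetteEdges, or_assoc] using he

/-- **The doubled activity has zero mean over each of its bonds**: if `A` is bounded,
measurable and does not depend on the two copies `(ℓ, ff)`, `(ℓ, tt)` of a bond `ℓ` of `p`,
then `∫ A · g_p d(dg_∞ ⊗ dg_∞) = 0` (`g_p = f̃_p(U)(1 + f̃_p(U')) + f̃_p(U')`; integrate out
`U_ℓ`, resp. `U'_ℓ`, first: `integral_infinitePi_eq_zero_of_update` and
`integral_update_plaqActivity`). This is the mechanism by which plaquette sets with a singly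
covered bond outside the supports of the observables drop out of the expansion
(Osterwalder–Seiler 1978 §3, Remark (3.9)). [folklore] -/
theorem integral_mul_dblActivity_eq_zero (hρ : Continuous ρ) (β : ℝ) (p : QuantumLattice.ZdPlaquette d)
    {ℓ : ZdEdge d} (hℓ : ℓ ∈ QuantumLattice.plaquetteEdges p) {A : DblConfig d G → ℝ} (hAm : Measurable A)
    {M : ℝ} (hAM : ∀ W, |A W| ≤ M) (hA : DependsOn A {e : DblEdge d | e.1 ≠ ℓ}) :
    ∫ W, A W * dblActivity ρ β p.1 p.2.1.1 p.2.1.2 W ∂dblHaar d G = 0 := by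
  classical
  obtain ⟨x, ⟨i, j⟩, hij⟩ := p
  simp only at hℓ ⊢
  have hij' : i ≠ j := ne_of_lt hij
  have he := eq_or_of_mem_plaquetteEdges (p := (x, ⟨(i, j), hij⟩)) hℓ
  simp only at he
  set f : ZdGaugeConfig d G → ℝ := plaqActivity ρ β x i j with hf
  have hfm : Measurable f := measurable_plaqActivity ρ hρ β x i j
  obtain ⟨B, -, hB⟩ := abs_plaqActivity_le ρ hρ (d := d) (G := G)
  set K := Real.exp (2 * |β| * B) - 1 with hK
  have hfb : ∀ U, |f U| ≤ K := fun U => hB β x i j U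
  have hK0 : 0 ≤ K := (abs_nonneg _).trans (hfb (fun _ => 1))
  have hM0 : 0 ≤ M := (abs_nonneg _).trans (hAM (fun _ => 1))
  -- `A` is unchanged by updating either copy of `ℓ`
  have hAupd : ∀ (W : DblConfig d G) (b : Bool) (g : G), A (Function.update W (ℓ, b) g) = A W :=
    fun W b g => hA fun e he => Function.update_of_ne (fun h => he (by rw [h])) _ _
  -- the two pieces of `A g_p`
  set T₁ : DblConfig d G → ℝ := fun W => A W * (1 + f W.snd) * f W.fst with hT₁
  set T₂ : DblConfig d G → ℝ := fun W => A W * f W.snd with hT₂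
  have hsplit : (fun W => A W * dblActivity ρ β x i j W) = fun W => T₁ W + T₂ W := by
    ext W; simp only [hT₁, hT₂, dblActivity_eq, hf]; ring
  have h1f : ∀ U, |1 + f U| ≤ 1 + K := fun U =>
    (abs_add_le 1 (f U)).trans (by rw [abs_one]; linarith [hfb U])
  have hT₁i : Integrable T₁ (dblHaar d G) := by
    refine Integrable.of_bound (((hAm.mul ((hfm.comp DblConfig.measurable_snd).const_add 1)).mul
      (hfm.comp DblConfig.measurable_fst)).aestronglyMeasurable) (M * (1 + K) * K)
      (ae_of_all _ fun W => ?_)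
    rw [Real.norm_eq_abs, hT₁]
    simp only [abs_mul]
    exact mul_le_mul (mul_le_mul (hAM W) (h1f _) (abs_nonneg _) hM0) (hfb _) (abs_nonneg _)
      (by positivity)
  have hT₂i : Integrable T₂ (dblHaar d G) := by
    refine Integrable.of_bound ((hAm.mul (hfm.comp DblConfig.measurable_snd)).aestronglyMeasurable)
      (M * K) (ae_of_all _ fun W => ?_)
    rw [Real.norm_eq_abs, hT₂]
    simp only [abs_mul]
    exact mul_le_mul (hAM W) (hfb _) (abs_nonneg _) hM0
  -- both pieces vanish after integrating out one copy of `ℓ`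
  have h1 : ∫ W, T₁ W ∂dblHaar d G = 0 := by
    refine Literature.Probability.LatticeModels.integral_infinitePi_eq_zero_of_update
      (fun _ : DblEdge d => haarProbability G) (ℓ, false) hT₁i fun W => ?_
    simp only [hT₁]
    simp_rw [hAupd, DblConfig.fst_update_false, DblConfig.snd_update_false, integral_const_mul, hf,
      integral_update_plaqActivity ρ hρ β x hij' (DblConfig.fst W) he, mul_zero]
  have h2 : ∫ W, T₂ W ∂dblHaar d G = 0 := by
    refine Literature.Probability.LatticeModels.integral_infinitePi_eq_zero_of_update
      (fun _ : DblEdge d => haarProbability G) (ℓ, true) hT₂i fun W => ?_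
    simp only [hT₂]
    simp_rw [hAupd, DblConfig.snd_update_true, integral_const_mul, hf,
      integral_update_plaqActivity ρ hρ β x hij' (DblConfig.snd W) he, mul_zero]
  rw [hsplit, integral_add hT₁i hT₂i, h1, h2, add_zero]

end Activity

end

end Literature.MathematicalPhysics.QuantumFieldTheory


/-! ## The local swap symmetry -/

namespace Literature.MathematicalPhysics.QuantumFieldTheory

open MeasureTheory Measure ProbabilityTheory

noncomputable section

section Swap

variable {d : ℕ} {G : Type*}

/-- The local swap of the two replicas on the bond set `L`: `(ℓ, b) ↦ (ℓ, ¬b)` for `ℓ ∈ L`,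
identity otherwise; an involution of the doubled bond set. [folklore] -/
def swapEquiv (L : Set (ZdEdge d)) [DecidablePred (· ∈ L)] : DblEdge d ≃ DblEdge d where
  toFun e := (e.1, if e.1 ∈ L then !e.2 else e.2)
  invFun e := (e.1, if e.1 ∈ L then !e.2 else e.2)
  left_inv e := by
    obtain ⟨ℓ, b⟩ := e
    by_cases h : ℓ ∈ L <;> simp [h]
  right_inv e := by
    obtain ⟨ℓ, b⟩ := e
    by_cases h : ℓ ∈ L <;> simp [h]

/-- `swapEquiv` unfolded. [folklore] -/
@[simp] theorem swapEquiv_apply (L : Set (ZdEdge d)) [DecidablePred (· ∈ L)] (e : DblEdge d) :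
    swapEquiv L e = (e.1, if e.1 ∈ L then !e.2 else e.2) := rfl

namespace DblConfig

/-- The configuration with the two replicas exchanged on the bonds of `L`. [folklore] -/
def swapOn (L : Set (ZdEdge d)) [DecidablePred (· ∈ L)] (W : DblConfig d G) : DblConfig d G :=
  fun e => W (swapEquiv L e)

variable (L : Set (ZdEdge d)) [DecidablePred (· ∈ L)]

/-- The first replica after the swap. [folklore] -/
theorem swapOn_fst_apply (W : DblConfig d G) (e : ZdEdge d) :
    (W.swapOn L).fst e = if e ∈ L then W.snd e else W.fst e := by
  by_cases h : e ∈ L <;> simp [swapOn, fst, snd, h]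

/-- The second replica after the swap. [folklore] -/
theorem swapOn_snd_apply (W : DblConfig d G) (e : ZdEdge d) :
    (W.swapOn L).snd e = if e ∈ L then W.fst e else W.snd e := by
  by_cases h : e ∈ L <;> simp [swapOn, fst, snd, h]

/-- On an observable supported inside `L`, the swap exchanges the replicas. [folklore] -/
theorem apply_fst_swapOn_of_subset {α : Type*} {F : ZdGaugeConfig d G → α} {E : Set (ZdEdge d)}
    (hF : DependsOn F E) (hE : E ⊆ L) (W : DblConfig d G) : F (W.swapOn L).fst = F W.snd :=
  hF fun e he => by rw [swapOn_fst_apply, if_pos (hE he)]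

/-- On an observable supported inside `L`, the swap exchanges the replicas. [folklore] -/
theorem apply_snd_swapOn_of_subset {α : Type*} {F : ZdGaugeConfig d G → α} {E : Set (ZdEdge d)}
    (hF : DependsOn F E) (hE : E ⊆ L) (W : DblConfig d G) : F (W.swapOn L).snd = F W.fst :=
  hF fun e he => by rw [swapOn_snd_apply, if_pos (hE he)]

/-- On an observable supported away from `L`, the swap does nothing. [folklore] -/
theorem apply_fst_swapOn_of_disjoint {α : Type*} {F : ZdGaugeConfig d G → α} {E : Set (ZdEdge d)}
    (hF : DependsOn F E) (hE : Disjoint E L) (W : DblConfig d G) : F (W.swapOn L).fst = F W.fst :=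
  hF fun e he => by rw [swapOn_fst_apply, if_neg (Set.disjoint_left.1 hE he)]

/-- On an observable supported away from `L`, the swap does nothing. [folklore] -/
theorem apply_snd_swapOn_of_disjoint {α : Type*} {F : ZdGaugeConfig d G → α} {E : Set (ZdEdge d)}
    (hF : DependsOn F E) (hE : Disjoint E L) (W : DblConfig d G) : F (W.swapOn L).snd = F W.snd :=
  hF fun e he => by rw [swapOn_snd_apply, if_neg (Set.disjoint_left.1 hE he)]

end DblConfig

variable [Group G] [TopologicalSpace G] [IsTopologicalGroup G] [CompactSpace G] [MeasurableSpace G]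
  [BorelSpace G]

/-- **The local swap preserves the doubled product Haar measure** (a permutation of the
coordinates of a product of identical factors), so integrals are invariant. [folklore] -/
theorem integral_comp_swapOn (L : Set (ZdEdge d)) [DecidablePred (· ∈ L)] {Φ : DblConfig d G → ℝ}
    (hΦ : AEStronglyMeasurable Φ (dblHaar d G)) :
    ∫ W, Φ (W.swapOn L) ∂dblHaar d G = ∫ W, Φ W ∂dblHaar d G :=
  Literature.Probability.LatticeModels.integral_comp_reindex_infinitePi (haarProbability G) (swapEquiv L) hΦ

variable {N : ℕ} (ρ : G →* Matrix (Fin N) (Fin N) ℂ)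

/-- The doubled activity of a plaquette with all bonds in `L` is swap invariant (its two factors
are exchanged). [folklore] -/
theorem dblActivity_swapOn_of_subset (L : Set (ZdEdge d)) [DecidablePred (· ∈ L)] (β : ℝ)
    (p : QuantumLattice.ZdPlaquette d) (hp : (QuantumLattice.plaquetteEdges p : Set (ZdEdge d)) ⊆ L)
    (W : DblConfig d G) :
    dblActivity ρ β p.1 p.2.1.1 p.2.1.2 (W.swapOn L) = dblActivity ρ β p.1 p.2.1.1 p.2.1.2 W := by
  unfold dblActivity
  rw [DblConfig.apply_fst_swapOn_of_subset L (dependsOn_plaqActivity ρ β p) hp,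
    DblConfig.apply_snd_swapOn_of_subset L (dependsOn_plaqActivity ρ β p) hp, mul_comm]

/-- The doubled activity of a plaquette with no bond in `L` is swap invariant. [folklore] -/
theorem dblActivity_swapOn_of_disjoint (L : Set (ZdEdge d)) [DecidablePred (· ∈ L)] (β : ℝ)
    (p : QuantumLattice.ZdPlaquette d) (hp : Disjoint (QuantumLattice.plaquetteEdges p : Set (ZdEdge d)) L)
    (W : DblConfig d G) :
    dblActivity ρ β p.1 p.2.1.1 p.2.1.2 (W.swapOn L) = dblActivity ρ β p.1 p.2.1.1 p.2.1.2 W := by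
  unfold dblActivity
  rw [DblConfig.apply_fst_swapOn_of_disjoint L (dependsOn_plaqActivity ρ β p) hp,
    DblConfig.apply_snd_swapOn_of_disjoint L (dependsOn_plaqActivity ρ β p) hp]

/-- **The bonds joined to `E₁` through `Q`** (including `E₁`): the region swapped in the proof
of the vanishing of disconnected terms. [folklore] -/
def joinedLinks (Q : Finset (QuantumLattice.ZdPlaquette d)) (E₁ : Finset (ZdEdge d)) : Set (ZdEdge d) :=
  {ℓ | ∃ e ∈ E₁, Relation.ReflTransGen (LinkAdj Q) e ℓ}

omit [Group G] [TopologicalSpace G] [IsTopologicalGroup G] [CompactSpace G] [MeasurableSpace G]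
  [BorelSpace G] in
/-- `E₁` is joined to itself. [folklore] -/
theorem subset_joinedLinks (Q : Finset (QuantumLattice.ZdPlaquette d)) (E₁ : Finset (ZdEdge d)) :
    (E₁ : Set (ZdEdge d)) ⊆ joinedLinks Q E₁ :=
  fun e he => ⟨e, Finset.mem_coe.1 he, Relation.ReflTransGen.refl⟩

omit [Group G] [TopologicalSpace G] [IsTopologicalGroup G] [CompactSpace G] [MeasurableSpace G]
  [BorelSpace G] in
/-- **All or nothing**: a plaquette of `Q` has all of its bonds joined to `E₁`, or none.
[folklore] -/
theorem plaquetteEdges_subset_or_disjoint_joinedLinks (Q : Finset (QuantumLattice.ZdPlaquette d))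
    (E₁ : Finset (ZdEdge d)) {p : QuantumLattice.ZdPlaquette d} (hp : p ∈ Q) :
    (QuantumLattice.plaquetteEdges p : Set (ZdEdge d)) ⊆ joinedLinks Q E₁ ∨
      Disjoint (QuantumLattice.plaquetteEdges p : Set (ZdEdge d)) (joinedLinks Q E₁) := by
  by_cases h : ∃ ℓ ∈ QuantumLattice.plaquetteEdges p, ℓ ∈ joinedLinks Q E₁
  · obtain ⟨ℓ, hℓ, e, he, heℓ⟩ := h
    exact Or.inl fun ℓ' hℓ' => ⟨e, he, heℓ.tail ⟨p, hp, hℓ, Finset.mem_coe.1 hℓ'⟩⟩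
  · push Not at h
    exact Or.inr (Set.disjoint_left.2 fun ℓ hℓ hj => h ℓ (Finset.mem_coe.1 hℓ) hj)

omit [Group G] [TopologicalSpace G] [IsTopologicalGroup G] [CompactSpace G] [MeasurableSpace G]
  [BorelSpace G] in
/-- If `E₁` is not joined to `E₂` through `Q`, no bond of `E₂` is joined to `E₁`. [folklore] -/
theorem disjoint_joinedLinks (Q : Finset (QuantumLattice.ZdPlaquette d)) {E₁ E₂ : Finset (ZdEdge d)}
    (h : ¬ ∃ e₁ ∈ E₁, ∃ e₂ ∈ E₂, Relation.ReflTransGen (LinkAdj Q) e₁ e₂) :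
    Disjoint (E₂ : Set (ZdEdge d)) (joinedLinks Q E₁) :=
  Set.disjoint_left.2 fun e₂ he₂ ⟨e₁, he₁, h12⟩ => h ⟨e₁, he₁, e₂, Finset.mem_coe.1 he₂, h12⟩

/-- **Vanishing of the disconnected terms** (the local swap symmetry of the replica
expansion): if `F₁` depends on `E₁`, `F₂` on `E₂`, and `E₁` is *not* joined to `E₂` through the
plaquette set `Q`, then
`∫ (F₁(U) - F₁(U')) (F₂(U) - F₂(U')) ∏_{p ∈ Q} g_p(U,U') d(dg_∞ ⊗ dg_∞) = 0`:
swapping the replicas on the bonds joined to `E₁` preserves the measure and every `g_p`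
(all-or-nothing) and `F₂(U) - F₂(U')`, and flips the sign of `F₁(U) - F₁(U')`. [folklore] -/
theorem integral_trunc_prod_dblActivity_eq_zero_of_not_joined (β : ℝ)
    (Q : Finset (QuantumLattice.ZdPlaquette d)) {E₁ E₂ : Finset (ZdEdge d)} {F₁ F₂ : ZdGaugeConfig d G → ℝ}
    (hF₁ : DependsOn F₁ (E₁ : Set (ZdEdge d))) (hF₂ : DependsOn F₂ (E₂ : Set (ZdEdge d)))
    (hΦ : AEStronglyMeasurable (fun W : DblConfig d G =>
      (F₁ W.fst - F₁ W.snd) * (F₂ W.fst - F₂ W.snd) *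
      ∏ p ∈ Q, dblActivity ρ β p.1 p.2.1.1 p.2.1.2 W) (dblHaar d G))
    (h : ¬ ∃ e₁ ∈ E₁, ∃ e₂ ∈ E₂, Relation.ReflTransGen (LinkAdj Q) e₁ e₂) :
    ∫ W, (F₁ W.fst - F₁ W.snd) * (F₂ W.fst - F₂ W.snd) *
        ∏ p ∈ Q, dblActivity ρ β p.1 p.2.1.1 p.2.1.2 W ∂dblHaar d G = 0 := by
  classical
  set L := joinedLinks Q E₁ with hL
  set Φ : DblConfig d G → ℝ := fun W => (F₁ W.fst - F₁ W.snd) * (F₂ W.fst - F₂ W.snd) *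
      ∏ p ∈ Q, dblActivity ρ β p.1 p.2.1.1 p.2.1.2 W with hΦdef
  have hswap : ∀ W : DblConfig d G, Φ (W.swapOn L) = -Φ W := by
    intro W
    simp only [hΦdef]
    rw [DblConfig.apply_fst_swapOn_of_subset L hF₁ (subset_joinedLinks Q E₁),
      DblConfig.apply_snd_swapOn_of_subset L hF₁ (subset_joinedLinks Q E₁),
      DblConfig.apply_fst_swapOn_of_disjoint L hF₂ (disjoint_joinedLinks Q h),
      DblConfig.apply_snd_swapOn_of_disjoint L hF₂ (disjoint_joinedLinks Q h),
      Finset.prod_congr rfl fun p hp => ?_]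
    · ring
    · rcases plaquetteEdges_subset_or_disjoint_joinedLinks Q E₁ hp with h1 | h1
      · exact dblActivity_swapOn_of_subset ρ L β p h1 W
      · exact dblActivity_swapOn_of_disjoint ρ L β p h1 W
  have hint := integral_comp_swapOn L (Φ := Φ) hΦ
  simp_rw [hswap, integral_neg] at hint
  change ∫ W, Φ W ∂dblHaar d G = 0
  linarith

end Swap

end

end Literature.MathematicalPhysics.QuantumFieldTheory


/-! ## Only connecting surfaces contribute -/

namespace Literature.MathematicalPhysics.QuantumFieldTheory

open MeasureTheory Measure ProbabilityTheory Finset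

noncomputable section

section Terms

variable {d N : ℕ} {G : Type*} [Group G] [TopologicalSpace G] [IsTopologicalGroup G]
  [CompactSpace G] [MeasurableSpace G] [BorelSpace G] (ρ : G →* Matrix (Fin N) (Fin N) ℂ)

/-- The product of doubled activities over a plaquette set, `g_Q = ∏_{p ∈ Q} g_p`. [folklore] -/
def dblActivityProd (β : ℝ) (Q : Finset (QuantumLattice.ZdPlaquette d)) (W : DblConfig d G) : ℝ :=
  ∏ p ∈ Q, dblActivity ρ β p.1 p.2.1.1 p.2.1.2 W

/-- The truncation kernel `(F₁(U) - F₁(U')) (F₂(U) - F₂(U'))` of the replica formula for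
`⟨F₁ F₂⟩ - ⟨F₁⟩⟨F₂⟩`. [folklore] -/
def truncKernel (F₁ F₂ : ZdGaugeConfig d G → ℝ) (W : DblConfig d G) : ℝ :=
  (F₁ W.fst - F₁ W.snd) * (F₂ W.fst - F₂ W.snd)

/-- The expansion term `I(Q) = ∫ (F₁(U) - F₁(U'))(F₂(U) - F₂(U')) ∏_{p ∈ Q} g_p`. [folklore] -/
def expansionTerm (β : ℝ) (F₁ F₂ : ZdGaugeConfig d G → ℝ) (Q : Finset (QuantumLattice.ZdPlaquette d)) : ℝ :=
  ∫ W, truncKernel F₁ F₂ W * dblActivityProd ρ β Q W ∂dblHaar d G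

variable {ρ}

/-- `g_Q` is measurable. [folklore] -/
theorem measurable_dblActivityProd (hρ : Continuous ρ) (β : ℝ) (Q : Finset (QuantumLattice.ZdPlaquette d)) :
    Measurable (dblActivityProd ρ β Q : DblConfig d G → ℝ) := by
  unfold dblActivityProd
  exact Finset.measurable_prod _ fun p _ => measurable_dblActivity ρ hρ β _ _ _

omit [Group G] [TopologicalSpace G] [IsTopologicalGroup G] [CompactSpace G] [BorelSpace G] in
/-- The truncation kernel is measurable. [folklore] -/
theorem measurable_truncKernel {F₁ F₂ : ZdGaugeConfig d G → ℝ} (h₁ : Measurable F₁)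
    (h₂ : Measurable F₂) : Measurable (truncKernel F₁ F₂ : DblConfig d G → ℝ) := by
  unfold truncKernel
  exact ((h₁.comp DblConfig.measurable_fst).sub (h₁.comp DblConfig.measurable_snd)).mul
    ((h₂.comp DblConfig.measurable_fst).sub (h₂.comp DblConfig.measurable_snd))

/-- `|g_Q| ≤ K^{#Q}` when `|g_p| ≤ K`. [folklore] -/
theorem abs_dblActivityProd_le {β K : ℝ}
    (hK : ∀ (x : Literature.Probability.LatticeModels.Site d) (i j : Fin d) (W : DblConfig d G), |dblActivity ρ β x i j W| ≤ K)
    (Q : Finset (QuantumLattice.ZdPlaquette d)) (W : DblConfig d G) :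
    |dblActivityProd ρ β Q W| ≤ K ^ Q.card := by
  unfold dblActivityProd
  rw [Finset.abs_prod]
  calc ∏ p ∈ Q, |dblActivity ρ β p.1 p.2.1.1 p.2.1.2 W| ≤ ∏ _p ∈ Q, K :=
        Finset.prod_le_prod (fun p _ => abs_nonneg _) fun p _ => hK _ _ _ W
    _ = K ^ Q.card := Finset.prod_const K

omit [Group G] [TopologicalSpace G] [IsTopologicalGroup G] [CompactSpace G] [MeasurableSpace G]
  [BorelSpace G] in
/-- `|(F₁(U) - F₁(U'))(F₂(U) - F₂(U'))| ≤ 4 M₁ M₂`. [folklore] -/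
theorem abs_truncKernel_le {F₁ F₂ : ZdGaugeConfig d G → ℝ} {M₁ M₂ : ℝ} (h₁ : ∀ U, |F₁ U| ≤ M₁)
    (h₂ : ∀ U, |F₂ U| ≤ M₂) (W : DblConfig d G) : |truncKernel F₁ F₂ W| ≤ 4 * M₁ * M₂ := by
  unfold truncKernel
  rw [abs_mul]
  have hM₁ : 0 ≤ M₁ := (abs_nonneg _).trans (h₁ W.fst)
  have e1 : |F₁ W.fst - F₁ W.snd| ≤ 2 * M₁ :=
    (abs_sub _ _).trans (by linarith [h₁ W.fst, h₁ W.snd])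
  have e2 : |F₂ W.fst - F₂ W.snd| ≤ 2 * M₂ :=
    (abs_sub _ _).trans (by linarith [h₂ W.fst, h₂ W.snd])
  calc |F₁ W.fst - F₁ W.snd| * |F₂ W.fst - F₂ W.snd| ≤ 2 * M₁ * (2 * M₂) :=
        mul_le_mul e1 e2 (abs_nonneg _) (by linarith)
    _ = 4 * M₁ * M₂ := by ring

/-- `g_Q` depends only on the doubled bonds of the plaquettes of `Q`. [folklore] -/
theorem dependsOn_dblActivityProd (β : ℝ) (Q : Finset (QuantumLattice.ZdPlaquette d)) :
    DependsOn (dblActivityProd ρ β Q : DblConfig d G → ℝ)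
      {e : DblEdge d | ∃ p ∈ Q, e.1 ∈ QuantumLattice.plaquetteEdges p} := by
  intro W W' h
  unfold dblActivityProd
  refine Finset.prod_congr rfl fun p hp => dependsOn_dblActivity ρ β p fun e he => h e ?_
  simp only [Finset.coe_product, Finset.coe_univ, Set.mem_prod, Finset.mem_coe, Set.mem_univ,
    and_true] at he
  exact ⟨p, hp, he⟩

omit [Group G] [TopologicalSpace G] [IsTopologicalGroup G] [CompactSpace G] [MeasurableSpace G]
  [BorelSpace G] in
/-- The truncation kernel depends only on the doubled bonds of `E₁ ∪ E₂`. [folklore] -/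
theorem dependsOn_truncKernel {F₁ F₂ : ZdGaugeConfig d G → ℝ} {E₁ E₂ : Finset (ZdEdge d)}
    (hF₁ : DependsOn F₁ (E₁ : Set (ZdEdge d))) (hF₂ : DependsOn F₂ (E₂ : Set (ZdEdge d))) :
    DependsOn (truncKernel F₁ F₂ : DblConfig d G → ℝ) {e : DblEdge d | e.1 ∈ E₁ ∨ e.1 ∈ E₂} := by
  intro W W' h
  have e1 : F₁ (DblConfig.fst W) = F₁ (DblConfig.fst W') :=
    hF₁ fun e he => h (e, false) (Or.inl (Finset.mem_coe.1 he))
  have e2 : F₁ (DblConfig.snd W) = F₁ (DblConfig.snd W') :=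
    hF₁ fun e he => h (e, true) (Or.inl (Finset.mem_coe.1 he))
  have e3 : F₂ (DblConfig.fst W) = F₂ (DblConfig.fst W') :=
    hF₂ fun e he => h (e, false) (Or.inr (Finset.mem_coe.1 he))
  have e4 : F₂ (DblConfig.snd W) = F₂ (DblConfig.snd W') :=
    hF₂ fun e he => h (e, true) (Or.inr (Finset.mem_coe.1 he))
  change (F₁ (DblConfig.fst W) - F₁ (DblConfig.snd W)) *
      (F₂ (DblConfig.fst W) - F₂ (DblConfig.snd W)) =
    (F₁ (DblConfig.fst W') - F₁ (DblConfig.snd W')) *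
      (F₂ (DblConfig.fst W') - F₂ (DblConfig.snd W'))
  rw [e1, e2, e3, e4]

/-- **Terms with a singly covered free bond vanish.** If a bond `ℓ ∉ E₁ ∪ E₂` lies in exactly
one plaquette `p₀` of `Q`, then `I(Q) = 0` (zero mean of `g_{p₀}` over the two copies of `ℓ`;
nothing else depends on them). [folklore] -/
theorem expansionTerm_eq_zero_of_singly_covered (hρ : Continuous ρ) (β : ℝ)
    {F₁ F₂ : ZdGaugeConfig d G → ℝ} (h₁m : Measurable F₁) (h₂m : Measurable F₂) {M₁ M₂ : ℝ}
    (h₁b : ∀ U, |F₁ U| ≤ M₁) (h₂b : ∀ U, |F₂ U| ≤ M₂) {E₁ E₂ : Finset (ZdEdge d)}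
    (hF₁ : DependsOn F₁ (E₁ : Set (ZdEdge d))) (hF₂ : DependsOn F₂ (E₂ : Set (ZdEdge d)))
    {Q : Finset (QuantumLattice.ZdPlaquette d)} {p₀ : QuantumLattice.ZdPlaquette d} (hp₀ : p₀ ∈ Q) {ℓ : ZdEdge d}
    (hℓ : ℓ ∈ QuantumLattice.plaquetteEdges p₀) (hℓ₁ : ℓ ∉ E₁) (hℓ₂ : ℓ ∉ E₂)
    (hone : ∀ p ∈ Q, ℓ ∈ QuantumLattice.plaquetteEdges p → p = p₀) :
    expansionTerm ρ β F₁ F₂ Q = 0 := by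
  classical
  obtain ⟨B, -, hB⟩ := abs_dblActivity_le ρ hρ (d := d) (G := G)
  set K := Real.exp (2 * |β| * B) ^ 2 - 1
  unfold expansionTerm
  -- split off `g_{p₀}`
  have hsplit : ∀ W : DblConfig d G, truncKernel F₁ F₂ W * dblActivityProd ρ β Q W =
      (truncKernel F₁ F₂ W * dblActivityProd ρ β (Q.erase p₀) W) *
        dblActivity ρ β p₀.1 p₀.2.1.1 p₀.2.1.2 W := by
    intro W
    unfold dblActivityProd
    rw [← Finset.mul_prod_erase Q _ hp₀]
    ring
  simp_rw [hsplit]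
  refine integral_mul_dblActivity_eq_zero ρ hρ β p₀ hℓ
    ((measurable_truncKernel h₁m h₂m).mul (measurable_dblActivityProd hρ β _))
    (M := 4 * M₁ * M₂ * K ^ (Q.erase p₀).card) (fun W => ?_) ?_
  · rw [abs_mul]
    exact mul_le_mul (abs_truncKernel_le h₁b h₂b W) (abs_dblActivityProd_le (hB β) _ W)
      (abs_nonneg _) (by have := (abs_nonneg _).trans (abs_truncKernel_le h₁b h₂b W); linarith)
  · -- nothing but `g_{p₀}` depends on the two copies of `ℓ`
    intro W W' h
    have hT := dependsOn_truncKernel (G := G) hF₁ hF₂ (x := W) (y := W') fun e he => h e ?_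
    · have hP := dependsOn_dblActivityProd (ρ := ρ) (G := G) β (Q.erase p₀) (x := W) (y := W')
        fun e he => h e ?_
      · change truncKernel F₁ F₂ W * dblActivityProd ρ β (Q.erase p₀) W =
          truncKernel F₁ F₂ W' * dblActivityProd ρ β (Q.erase p₀) W'
        rw [hT, hP]
      · obtain ⟨p, hp, hep⟩ := he
        simp only [Set.mem_setOf_eq]
        rintro rfl
        exact (Finset.mem_erase.1 hp).1 (hone p (Finset.mem_erase.1 hp).2 hep)
    · simp only [Set.mem_setOf_eq]
      rintro rfl
      rcases he with he | he
      · exact hℓ₁ he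
      · exact hℓ₂ he

/-- **Only connecting surfaces contribute** to the replica expansion of the truncated
expectation: `I(Q) = 0` unless `Q` is a connecting surface for the supports `E₁`, `E₂`
(disconnected: the swap symmetry; a free bond covered once: the zero mean). [folklore] -/
theorem expansionTerm_eq_zero_of_not_isConnectingSurface (hρ : Continuous ρ) (β : ℝ)
    {F₁ F₂ : ZdGaugeConfig d G → ℝ} (h₁m : Measurable F₁) (h₂m : Measurable F₂) {M₁ M₂ : ℝ}
    (h₁b : ∀ U, |F₁ U| ≤ M₁) (h₂b : ∀ U, |F₂ U| ≤ M₂) {E₁ E₂ : Finset (ZdEdge d)}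
    (hF₁ : DependsOn F₁ (E₁ : Set (ZdEdge d))) (hF₂ : DependsOn F₂ (E₂ : Set (ZdEdge d)))
    {Q : Finset (QuantumLattice.ZdPlaquette d)} (hQ : ¬ IsConnectingSurface E₁ E₂ Q) :
    expansionTerm ρ β F₁ F₂ Q = 0 := by
  classical
  unfold IsConnectingSurface at hQ
  rw [not_and_or] at hQ
  rcases hQ with hcov | hconn
  · -- a free bond covered once
    push Not at hcov
    obtain ⟨p₀, hp₀, ℓ, hℓ, hℓ₁, hℓ₂, hlt⟩ := hcov
    refine expansionTerm_eq_zero_of_singly_covered hρ β h₁m h₂m h₁b h₂b hF₁ hF₂ hp₀ hℓ hℓ₁ hℓ₂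
      fun p hp hep => ?_
    -- `linkCover Q ℓ < 2` and both `p`, `p₀` cover `ℓ`
    by_contra hne
    have h2 : 2 ≤ linkCover Q ℓ := by
      unfold linkCover
      have hsub : ({p, p₀} : Finset (QuantumLattice.ZdPlaquette d)) ⊆
          Q.filter fun q => ℓ ∈ QuantumLattice.plaquetteEdges q := by
        intro q hq
        simp only [Finset.mem_insert, Finset.mem_singleton] at hq
        rcases hq with rfl | rfl
        · exact Finset.mem_filter.2 ⟨hp, hep⟩
        · exact Finset.mem_filter.2 ⟨hp₀, hℓ⟩
      calc 2 = ({p, p₀} : Finset (QuantumLattice.ZdPlaquette d)).card := (Finset.card_pair hne).symm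
        _ ≤ _ := Finset.card_le_card hsub
    omega
  · -- disconnected supports
    unfold expansionTerm truncKernel dblActivityProd
    obtain ⟨B, -, hB⟩ := abs_dblActivity_le ρ hρ (d := d) (G := G)
    refine integral_trunc_prod_dblActivity_eq_zero_of_not_joined ρ β Q hF₁ hF₂ ?_ hconn
    exact (((measurable_truncKernel h₁m h₂m).mul
      (measurable_dblActivityProd hρ β Q)).aestronglyMeasurable :
      AEStronglyMeasurable (fun W => truncKernel F₁ F₂ W * dblActivityProd ρ β Q W) (dblHaar d G))

end Terms

end

end Literature.MathematicalPhysics.QuantumFieldTheory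


/-! ## Expectations as ratios of product-Haar integrals; the replica formula -/

namespace Literature.MathematicalPhysics.QuantumFieldTheory

open MeasureTheory Measure ProbabilityTheory Finset

noncomputable section

section Expect

variable {d N : ℕ} {G : Type*} [Group G] [TopologicalSpace G] [IsTopologicalGroup G]
  [CompactSpace G] [MeasurableSpace G] [BorelSpace G] (ρ : G →* Matrix (Fin N) (Fin N) ℂ)

/-- The plaquettes of a finite region as oriented plaquettes `AQFT.ZdPlaquette d` (the elements
of `plaquettesIn Λ` carry `i < j`). [folklore] -/
def plaqSet (Λ : Finset (Literature.Probability.LatticeModels.Site d)) : Finset (QuantumLattice.ZdPlaquette d) :=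
  (plaquettesIn Λ).attach.image fun p => (p.1.1, ⟨p.1.2, (Finset.mem_filter.1 p.2).2.1⟩)

/-- The normalised Gibbs factor `W̃(U) = ∏_{p ∈ Λ'} (1 + f̃_p(U))`. [folklore] -/
def gibbsFactor (β : ℝ) (Λ : Finset (Literature.Probability.LatticeModels.Site d)) (U : ZdGaugeConfig d G) : ℝ :=
  ∏ p ∈ plaqSet Λ, (1 + plaqActivity ρ β p.1 p.2.1.1 p.2.1.2 U)

variable {ρ}

omit [TopologicalSpace G] [IsTopologicalGroup G] [CompactSpace G] [MeasurableSpace G]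
  [BorelSpace G] in
/-- Sums over `plaquettesIn Λ` are sums over `plaqSet Λ`. [folklore] -/
theorem prod_plaqSet {M : Type*} [CommMonoid M] (Λ : Finset (Literature.Probability.LatticeModels.Site d))
    (f : Literature.Probability.LatticeModels.Site d → Fin d → Fin d → M) :
    ∏ p ∈ plaqSet Λ, f p.1 p.2.1.1 p.2.1.2 = ∏ p ∈ plaquettesIn Λ, f p.1 p.2.1 p.2.2 := by
  classical
  unfold plaqSet
  rw [Finset.prod_image]
  · exact Finset.prod_attach (plaquettesIn Λ) fun p => f p.1 p.2.1 p.2.2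
  · intro p _ q _ h
    simp only [Prod.mk.injEq, Subtype.mk.injEq] at h
    exact Subtype.ext (Prod.ext h.1 h.2)

/-- `exp(-β S_Λ(U)) = (e^{-βN} c(β))^{|Λ'|} · W̃(U)`. [folklore] -/
theorem exp_neg_mul_zdWilsonAction (hρ : Continuous ρ) (β : ℝ) (Λ : Finset (Literature.Probability.LatticeModels.Site d))
    (U : ZdGaugeConfig d G) :
    Real.exp (-β * zdWilsonAction ρ Λ U) =
      (Real.exp (-β * N) * plaqNorm ρ β (G := G)) ^ (plaquettesIn Λ).card *
        gibbsFactor ρ β Λ U := by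
  have hc : plaqNorm ρ β (G := G) ≠ 0 := (plaqNorm_pos ρ hρ β).ne'
  have hpt : ∀ (x : Literature.Probability.LatticeModels.Site d) (i j : Fin d),
      Real.exp (-β * ((N : ℝ) - (ρ (U.plaquette x i j)).trace.re)) =
        (Real.exp (-β * N) * plaqNorm ρ β (G := G)) * (1 + plaqActivity ρ β x i j U) := by
    intro x i j
    unfold plaqActivity
    rw [add_sub_cancel, show -β * ((N : ℝ) - (ρ (U.plaquette x i j)).trace.re) =
      -β * N + β * (ρ (U.plaquette x i j)).trace.re by ring, Real.exp_add]
    field_simp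
  unfold zdWilsonAction
  rw [Finset.mul_sum, Real.exp_sum]
  simp_rw [hpt]
  rw [Finset.prod_mul_distrib, Finset.prod_const, gibbsFactor,
    prod_plaqSet Λ fun x i j => 1 + plaqActivity ρ β x i j U]

/-- `W̃ > 0`. [folklore] -/
theorem gibbsFactor_pos (hρ : Continuous ρ) (β : ℝ) (Λ : Finset (Literature.Probability.LatticeModels.Site d))
    (U : ZdGaugeConfig d G) : 0 < gibbsFactor ρ β Λ U := by
  unfold gibbsFactor
  refine Finset.prod_pos fun p _ => ?_
  unfold plaqActivity
  rw [add_sub_cancel]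
  exact div_pos (Real.exp_pos _) (plaqNorm_pos ρ hρ β)

/-- `W̃` is measurable. [folklore] -/
theorem measurable_gibbsFactor (hρ : Continuous ρ) (β : ℝ) (Λ : Finset (Literature.Probability.LatticeModels.Site d)) :
    Measurable (gibbsFactor ρ β Λ : ZdGaugeConfig d G → ℝ) := by
  unfold gibbsFactor
  exact Finset.measurable_prod _ fun p _ => (measurable_plaqActivity ρ hρ β _ _ _).const_add 1

/-- `W̃ ≤ (1 + K)^{|Λ'|}` with `K` the activity bound. [folklore] -/
theorem gibbsFactor_le (hρ : Continuous ρ) :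
    ∃ B : ℝ, 0 ≤ B ∧ ∀ (β : ℝ) (Λ : Finset (Literature.Probability.LatticeModels.Site d)) (U : ZdGaugeConfig d G),
      gibbsFactor ρ β Λ U ≤ Real.exp (2 * |β| * B) ^ (plaqSet Λ).card := by
  obtain ⟨B, hB0, hB⟩ := abs_plaqActivity_le ρ hρ (d := d) (G := G)
  refine ⟨B, hB0, fun β Λ U => ?_⟩
  unfold gibbsFactor
  rw [← Finset.prod_const]
  refine Finset.prod_le_prod (fun p _ => ?_) fun p _ => ?_
  · unfold plaqActivity
    rw [add_sub_cancel]
    exact (div_pos (Real.exp_pos _) (plaqNorm_pos ρ hρ β)).le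
  · have := (abs_le.1 (hB β p.1 p.2.1.1 p.2.1.2 U)).2
    linarith

/-- `W̃` depends only on the bonds of the plaquettes of `Λ`. [folklore] -/
theorem dependsOn_gibbsFactor (β : ℝ) (Λ : Finset (Literature.Probability.LatticeModels.Site d)) :
    DependsOn (gibbsFactor ρ β Λ : ZdGaugeConfig d G → ℝ)
      (((plaqSet Λ).biUnion QuantumLattice.plaquetteEdges : Finset (ZdEdge d)) : Set (ZdEdge d)) := by
  intro U V h
  unfold gibbsFactor
  refine Finset.prod_congr rfl fun p hp => ?_
  rw [dependsOn_plaqActivity ρ β p fun e he => h e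
    (Finset.mem_coe.2 (Finset.mem_biUnion.2 ⟨p, hp, Finset.mem_coe.1 he⟩))]

/-- **Expectations as ratios of product-Haar integrals**:
`⟨F⟩_{Λ,β} = ∫ F W̃ dg_∞ / ∫ W̃ dg_∞` for every `F`. [folklore] -/
theorem zdExpect_eq_div (hρ : Continuous ρ) (β : ℝ) (Λ : Finset (Literature.Probability.LatticeModels.Site d))
    (F : ZdGaugeConfig d G → ℝ) :
    zdExpect ρ β Λ F = (∫ U, gibbsFactor ρ β Λ U * F U ∂zdHaar d G) /
      ∫ U, gibbsFactor ρ β Λ U ∂zdHaar d G := by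
  set Kc : ℝ := (Real.exp (-β * N) * plaqNorm ρ β (G := G)) ^ (plaquettesIn Λ).card with hKc
  have hKc : 0 < Kc := pow_pos (mul_pos (Real.exp_pos _) (plaqNorm_pos ρ hρ β)) _
  set w : ZdGaugeConfig d G → ℝ := fun U => Real.exp (-β * zdWilsonAction ρ Λ U) with hw
  have hwW : ∀ U, w U = Kc * gibbsFactor ρ β Λ U := fun U => exp_neg_mul_zdWilsonAction hρ β Λ U
  have hwpos : ∀ U, 0 < w U := fun U => Real.exp_pos _
  have hSm : Measurable (zdWilsonAction ρ Λ : ZdGaugeConfig d G → ℝ) := by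
    unfold zdWilsonAction
    exact Finset.measurable_sum _ fun p _ =>
      measurable_const.sub (measurable_trace_re_plaquette ρ hρ _ _ _)
  have hwm : Measurable w := Real.measurable_exp.comp (hSm.const_mul (-β))
  -- `w` is bounded, hence integrable
  obtain ⟨B, -, hB⟩ := gibbsFactor_le hρ (d := d) (G := G) (ρ := ρ)
  have hWint : Integrable (gibbsFactor ρ β Λ) (zdHaar d G) :=
    Integrable.of_bound (measurable_gibbsFactor hρ β Λ).aestronglyMeasurable _
      (ae_of_all _ fun U => by
        rw [Real.norm_eq_abs, abs_of_pos (gibbsFactor_pos hρ β Λ U)]; exact hB β Λ U)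
  have hwint : Integrable w (zdHaar d G) := by
    rw [show w = fun U => Kc * gibbsFactor ρ β Λ U from funext hwW]; exact hWint.const_mul Kc
  -- the density and the partition function
  have hZ : zdPartitionFunction (d := d) ρ β Λ = ENNReal.ofReal (∫ U, w U ∂zdHaar d G) := by
    rw [zdPartitionFunction_eq_lintegral, ofReal_integral_eq_lintegral_ofReal hwint
      (ae_of_all _ fun U => (hwpos U).le)]
  have hIw : 0 < ∫ U, w U ∂zdHaar d G := by
    have h := ENNReal.toReal_pos (zdPartitionFunction_pos ρ hρ β Λ).ne'
      (zdPartitionFunction_lt_top ρ hρ β Λ).ne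
    rw [hZ, ENNReal.toReal_ofReal (integral_nonneg fun U => (hwpos U).le)] at h
    exact h
  have hwd : ∫ U, F U ∂(zdHaar d G).withDensity (fun U => ENNReal.ofReal (w U)) =
      ∫ U, w U * F U ∂zdHaar d G := by
    rw [show (fun U => ENNReal.ofReal (w U)) = fun U => ((w U).toNNReal : ENNReal) from rfl,
      integral_withDensity_eq_integral_smul (Measurable.real_toNNReal hwm)]
    refine integral_congr_ae (ae_of_all _ fun U => ?_)
    simp only [NNReal.smul_def, Real.coe_toNNReal _ (hwpos U).le, smul_eq_mul]
  -- compute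
  unfold zdExpect zdWilsonMeasure zdWilsonWeight
  rw [integral_smul_measure, hZ, ENNReal.toReal_inv, ENNReal.toReal_ofReal hIw.le]
  change (∫ U, w U ∂zdHaar d G)⁻¹ •
    ∫ U, F U ∂(zdHaar d G).withDensity (fun U => ENNReal.ofReal (w U)) = _
  rw [hwd, smul_eq_mul]
  simp_rw [hwW, mul_assoc, integral_const_mul]
  rw [← div_eq_inv_mul, mul_div_mul_left _ _ hKc.ne']

/-! ### The replica formula for the truncated expectation -/

variable (ρ) in
/-- The doubled Gibbs factor `W̃(U) W̃(U') = ∏_p (1 + g_p)`. [folklore] -/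
def dblGibbs (β : ℝ) (Λ : Finset (Literature.Probability.LatticeModels.Site d)) (W : DblConfig d G) : ℝ :=
  gibbsFactor ρ β Λ W.fst * gibbsFactor ρ β Λ W.snd

/-- `W̃(U) W̃(U') = ∏_p (1 + g_p) = Σ_{Q ⊆ Λ'} g_Q`. [folklore] -/
theorem dblGibbs_eq_sum (β : ℝ) (Λ : Finset (Literature.Probability.LatticeModels.Site d)) (W : DblConfig d G) :
    dblGibbs ρ β Λ W = ∑ Q ∈ (plaqSet Λ).powerset, dblActivityProd ρ β Q W := by
  unfold dblGibbs gibbsFactor dblActivityProd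
  rw [← Finset.prod_mul_distrib, ← Finset.prod_one_add]
  refine Finset.prod_congr rfl fun p _ => ?_
  unfold dblActivity
  ring

/-- A bounded measurable local observable times the Gibbs factor is a bounded measurable local
observable (bookkeeping for the replica factorisation). [folklore] -/
theorem gibbsFactor_mul_aux (hρ : Continuous ρ) (β : ℝ) (Λ : Finset (Literature.Probability.LatticeModels.Site d))
    {F : ZdGaugeConfig d G → ℝ} (hFm : Measurable F) {E : Finset (ZdEdge d)}
    (hF : DependsOn F (E : Set (ZdEdge d))) :
    Measurable (fun U => gibbsFactor ρ β Λ U * F U) ∧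
      DependsOn (fun U : ZdGaugeConfig d G => gibbsFactor ρ β Λ U * F U)
        ((((plaqSet Λ).biUnion QuantumLattice.plaquetteEdges) ∪ E : Finset (ZdEdge d)) : Set (ZdEdge d)) := by
  refine ⟨(measurable_gibbsFactor hρ β Λ).mul hFm, fun U V h => ?_⟩
  change gibbsFactor ρ β Λ U * F U = gibbsFactor ρ β Λ V * F V
  rw [dependsOn_gibbsFactor (ρ := ρ) β Λ fun e he => h e (by
      rw [Finset.coe_union]; exact Or.inl he),
    hF fun e he => h e (by rw [Finset.coe_union]; exact Or.inr he)]

/-- **The replica formula**: for bounded measurable local observables,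
`⟨F₁ F₂⟩ - ⟨F₁⟩⟨F₂⟩ = ∫ (F₁(U)-F₁(U'))(F₂(U)-F₂(U')) W̃(U)W̃(U') / (2 ∫ W̃(U)W̃(U'))`,
all integrals over the doubled product Haar measure, and `∫ W̃(U) W̃(U') = (∫ W̃)² > 0`.
[folklore] -/
theorem truncated_eq_integral_div (hρ : Continuous ρ) (β : ℝ) (Λ : Finset (Literature.Probability.LatticeModels.Site d))
    {F₁ F₂ : ZdGaugeConfig d G → ℝ} (h₁m : Measurable F₁) (h₂m : Measurable F₂) {M₁ M₂ : ℝ}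
    (h₁b : ∀ U, |F₁ U| ≤ M₁) (h₂b : ∀ U, |F₂ U| ≤ M₂) {E₁ E₂ : Finset (ZdEdge d)}
    (hF₁ : DependsOn F₁ (E₁ : Set (ZdEdge d))) (hF₂ : DependsOn F₂ (E₂ : Set (ZdEdge d))) :
    zdExpect ρ β Λ (fun U => F₁ U * F₂ U) - zdExpect ρ β Λ F₁ * zdExpect ρ β Λ F₂ =
      (∫ W, truncKernel F₁ F₂ W * dblGibbs ρ β Λ W ∂dblHaar d G) /
        (2 * ∫ W, dblGibbs ρ β Λ W ∂dblHaar d G) ∧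
    ∫ W, dblGibbs ρ β Λ W ∂dblHaar d G = (∫ U, gibbsFactor ρ β Λ U ∂zdHaar d G) ^ 2 ∧
    0 < ∫ U, gibbsFactor ρ β Λ U ∂zdHaar d G := by
  classical
  -- the four basic integrals
  set Wt : ZdGaugeConfig d G → ℝ := gibbsFactor ρ β Λ with hWt
  set z := ∫ U, Wt U ∂zdHaar d G with hz
  set a := ∫ U, Wt U * (F₁ U * F₂ U) ∂zdHaar d G with ha
  set b := ∫ U, Wt U * F₁ U ∂zdHaar d G with hb
  set c := ∫ U, Wt U * F₂ U ∂zdHaar d G with hc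
  have hWm : Measurable Wt := measurable_gibbsFactor hρ β Λ
  have hWdep := dependsOn_gibbsFactor (ρ := ρ) (G := G) β Λ
  obtain ⟨h12m, h12dep⟩ := gibbsFactor_mul_aux hρ β Λ (h₁m.mul h₂m) (E := E₁ ∪ E₂)
    (F := fun U => F₁ U * F₂ U) (fun U V h => by
      change F₁ U * F₂ U = F₁ V * F₂ V
      rw [hF₁ fun e he => h e (by rw [Finset.coe_union]; exact Or.inl he),
        hF₂ fun e he => h e (by rw [Finset.coe_union]; exact Or.inr he)])
  obtain ⟨h1m', h1dep⟩ := gibbsFactor_mul_aux hρ β Λ h₁m hF₁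
  obtain ⟨h2m', h2dep⟩ := gibbsFactor_mul_aux hρ β Λ h₂m hF₂
  have hWdep' : DependsOn Wt ((((plaqSet Λ).biUnion QuantumLattice.plaquetteEdges) ∪ ∅ : Finset (ZdEdge d)) :
      Set (ZdEdge d)) := by rw [Finset.union_empty]; exact hWdep
  -- positivity of `z`
  have hzpos : 0 < z := by
    rw [hz]
    have hint : Integrable Wt (zdHaar d G) := by
      obtain ⟨B, -, hB⟩ := gibbsFactor_le hρ (d := d) (G := G) (ρ := ρ)
      exact Integrable.of_bound hWm.aestronglyMeasurable _ (ae_of_all _ fun U => by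
        rw [Real.norm_eq_abs, abs_of_pos (gibbsFactor_pos hρ β Λ U)]; exact hB β Λ U)
    exact (integral_pos_iff_support_of_nonneg (fun U => (gibbsFactor_pos hρ β Λ U).le) hint).2
      (by
        rw [show Function.support Wt = Set.univ from
          Set.eq_univ_of_forall fun U => (gibbsFactor_pos hρ β Λ U).ne', measure_univ]
        exact one_pos)
  -- the replica integrals
  have hI : ∫ W, truncKernel F₁ F₂ W * dblGibbs ρ β Λ W ∂dblHaar d G = 2 * (a * z - b * c) := by
    have e1 := integral_fst_mul_snd_dblHaar h12m hWm h12dep hWdep'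
    have e2 := integral_fst_mul_snd_dblHaar hWm h12m hWdep' h12dep
    have e3 := integral_fst_mul_snd_dblHaar h1m' h2m' h1dep h2dep
    have e4 := integral_fst_mul_snd_dblHaar h2m' h1m' h2dep h1dep
    have hsplit : ∀ W : DblConfig d G, truncKernel F₁ F₂ W * dblGibbs ρ β Λ W =
        (Wt W.fst * (F₁ W.fst * F₂ W.fst)) * Wt W.snd +
          Wt W.fst * (Wt W.snd * (F₁ W.snd * F₂ W.snd)) -
          (Wt W.fst * F₁ W.fst) * (Wt W.snd * F₂ W.snd) -
          (Wt W.fst * F₂ W.fst) * (Wt W.snd * F₁ W.snd) := by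
      intro W; unfold truncKernel dblGibbs; ring
    simp_rw [hsplit]
    -- integrability of the four pieces (bounded measurable on a probability space)
    obtain ⟨B, -, hB⟩ := gibbsFactor_le hρ (d := d) (G := G) (ρ := ρ)
    set KW := Real.exp (2 * |β| * B) ^ (plaqSet Λ).card
    have hWb : ∀ U, |Wt U| ≤ KW := fun U => by
      rw [abs_of_pos (gibbsFactor_pos hρ β Λ U)]; exact hB β Λ U
    have hM₁ : 0 ≤ M₁ := (abs_nonneg _).trans (h₁b fun _ => 1)
    have hM₂ : 0 ≤ M₂ := (abs_nonneg _).trans (h₂b fun _ => 1)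
    have hKW : 0 ≤ KW := (abs_nonneg _).trans (hWb fun _ => 1)
    have bnd : ∀ {f : DblConfig d G → ℝ} (C : ℝ), Measurable f → (∀ W, |f W| ≤ C) →
        Integrable f (dblHaar d G) := fun C hf hC =>
      Integrable.of_bound hf.aestronglyMeasurable C (ae_of_all _ fun W => by
        rw [Real.norm_eq_abs]; exact hC W)
    have mf := DblConfig.measurable_fst (d := d) (G := G)
    have ms := DblConfig.measurable_snd (d := d) (G := G)
    have i1 : Integrable (fun W : DblConfig d G => Wt W.fst * (F₁ W.fst * F₂ W.fst) * Wt W.snd)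
        (dblHaar d G) := by
      refine bnd (KW * (M₁ * M₂) * KW) ((h12m.comp mf).mul (hWm.comp ms)) fun W => ?_
      rw [abs_mul, abs_mul, abs_mul]
      exact mul_le_mul (mul_le_mul (hWb _) (mul_le_mul (h₁b _) (h₂b _) (abs_nonneg _) hM₁)
        (by positivity) hKW) (hWb _) (abs_nonneg _) (by positivity)
    have i2 : Integrable (fun W : DblConfig d G => Wt W.fst * (Wt W.snd * (F₁ W.snd * F₂ W.snd)))
        (dblHaar d G) := by
      refine bnd (KW * (KW * (M₁ * M₂))) ((hWm.comp mf).mul (h12m.comp ms)) fun W => ?_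
      rw [abs_mul, abs_mul, abs_mul]
      exact mul_le_mul (hWb _) (mul_le_mul (hWb _) (mul_le_mul (h₁b _) (h₂b _) (abs_nonneg _) hM₁)
        (by positivity) hKW) (by positivity) hKW
    have i3 : Integrable (fun W : DblConfig d G => Wt W.fst * F₁ W.fst * (Wt W.snd * F₂ W.snd))
        (dblHaar d G) := by
      refine bnd (KW * M₁ * (KW * M₂)) ((h1m'.comp mf).mul (h2m'.comp ms)) fun W => ?_
      rw [abs_mul, abs_mul, abs_mul]
      exact mul_le_mul (mul_le_mul (hWb _) (h₁b _) (abs_nonneg _) hKW)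
        (mul_le_mul (hWb _) (h₂b _) (abs_nonneg _) hKW) (by positivity) (by positivity)
    have i4 : Integrable (fun W : DblConfig d G => Wt W.fst * F₂ W.fst * (Wt W.snd * F₁ W.snd))
        (dblHaar d G) := by
      refine bnd (KW * M₂ * (KW * M₁)) ((h2m'.comp mf).mul (h1m'.comp ms)) fun W => ?_
      rw [abs_mul, abs_mul, abs_mul]
      exact mul_le_mul (mul_le_mul (hWb _) (h₂b _) (abs_nonneg _) hKW)
        (mul_le_mul (hWb _) (h₁b _) (abs_nonneg _) hKW) (by positivity) (by positivity)
    have i12 : Integrable (fun W : DblConfig d G => Wt W.fst * (F₁ W.fst * F₂ W.fst) * Wt W.snd +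
        Wt W.fst * (Wt W.snd * (F₁ W.snd * F₂ W.snd))) (dblHaar d G) := i1.add i2
    have i123 : Integrable (fun W : DblConfig d G => Wt W.fst * (F₁ W.fst * F₂ W.fst) * Wt W.snd +
        Wt W.fst * (Wt W.snd * (F₁ W.snd * F₂ W.snd)) -
          Wt W.fst * F₁ W.fst * (Wt W.snd * F₂ W.snd)) (dblHaar d G) := i12.sub i3
    rw [integral_sub i123 i4, integral_sub i12 i3, integral_add i1 i2]
    rw [e1, e2, e3, e4]
    ring
  have hZ2 : ∫ W, dblGibbs ρ β Λ W ∂dblHaar d G = z ^ 2 := by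
    unfold dblGibbs
    rw [integral_fst_mul_snd_dblHaar hWm hWm hWdep' hWdep', sq]
  refine ⟨?_, hZ2, hzpos⟩
  rw [zdExpect_eq_div hρ, zdExpect_eq_div hρ, zdExpect_eq_div hρ, hI, hZ2]
  change a / z - b / z * (c / z) = 2 * (a * z - b * c) / (2 * z ^ 2)
  field_simp

/-- **The truncated expectation as a sum over plaquette sets**:
`⟨F₁ F₂⟩ - ⟨F₁⟩⟨F₂⟩ = (Σ_{Q ⊆ Λ'} I(Q)) / (2 Z₂)` with `Z₂ = ∫ W̃(U) W̃(U') = (∫ W̃)² > 0`.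
[folklore] -/
theorem truncated_eq_sum_expansionTerm_div (hρ : Continuous ρ) (β : ℝ)
    (Λ : Finset (Literature.Probability.LatticeModels.Site d)) {F₁ F₂ : ZdGaugeConfig d G → ℝ} (h₁m : Measurable F₁)
    (h₂m : Measurable F₂) {M₁ M₂ : ℝ} (h₁b : ∀ U, |F₁ U| ≤ M₁) (h₂b : ∀ U, |F₂ U| ≤ M₂)
    {E₁ E₂ : Finset (ZdEdge d)} (hF₁ : DependsOn F₁ (E₁ : Set (ZdEdge d)))
    (hF₂ : DependsOn F₂ (E₂ : Set (ZdEdge d))) :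
    zdExpect ρ β Λ (fun U => F₁ U * F₂ U) - zdExpect ρ β Λ F₁ * zdExpect ρ β Λ F₂ =
      (∑ Q ∈ (plaqSet Λ).powerset, expansionTerm ρ β F₁ F₂ Q) /
        (2 * ∫ W, dblGibbs ρ β Λ W ∂dblHaar d G) := by
  obtain ⟨h, -, -⟩ := truncated_eq_integral_div hρ β Λ h₁m h₂m h₁b h₂b hF₁ hF₂
  rw [h]
  congr 1
  simp_rw [dblGibbs_eq_sum, Finset.mul_sum]
  rw [integral_finsetSum]
  · rfl
  · intro Q _
    obtain ⟨B, -, hB⟩ := abs_dblActivity_le ρ hρ (d := d) (G := G)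
    refine Integrable.of_bound (((measurable_truncKernel h₁m h₂m).mul
      (measurable_dblActivityProd hρ β Q)).aestronglyMeasurable)
      (4 * M₁ * M₂ * (Real.exp (2 * |β| * B) ^ 2 - 1) ^ Q.card) (ae_of_all _ fun W => ?_)
    rw [Real.norm_eq_abs, abs_mul]
    exact mul_le_mul (abs_truncKernel_le h₁b h₂b W) (abs_dblActivityProd_le (hB β) Q W)
      (abs_nonneg _) (by have := (abs_nonneg _).trans (abs_truncKernel_le h₁b h₂b W); linarith)

end Expect

end

end Literature.MathematicalPhysics.QuantumFieldTheory
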